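import Summits.BirchSwinnertonDyer.Rank1Residual.X11b.CoinducedShiftExact
import Literature.NumberTheory.GaloisRepresentations.CohomologicalDimensionProofs
import Literature.NumberTheory.GaloisRepresentations.ShapiroInjective
import Literature.NumberTheory.EllipticCurves.IwasawaCoinvariantsRankProofs
import Literature.NumberTheory.EllipticCurves.H1CorestrictionIndexTwo
import HarnessLib

/-!
# X11b, route R1 — PROCYCLIC DESCENT: for `H = ker(κ : G ↠ ℤ_p)` and a `p`-primary discrete
# `G`-module `A`, (a) `res : H¹(G, A) ↠ H¹(H, A)^{γ}` and (b) `H²(G, A) = 0 ⟹ H¹(H, A)_Γ = 0`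

HONEST FRAMING (cell `b2b-bsdres`, run/shared/lean/b2b/bsd-rank1-residual/, verbatim in every
file): the goal of the cell is to DELETE the COMBINATION-SHAPED residual classes of the
Birch–Swinnerton-Dyer formula for ALL analytic-rank `≤ 1` elliptic curves over `ℚ` — "full BSD
formula for every rank `≤ 1` curve in class `C`" assembled STRICTLY from published theorems — so
that the rank-`≤ 1` remainder becomes exactly the CONSTRUCTION-SHAPED classes, which are TYPED
(missing-input `Prop`s), NOT attempted. This is not "finishing BSD". Sub-cell
`b2b-bsdres-multr1-p1` (X11b, route R1 = Castella 2018 Thm. A re-proved along the author's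
erratum); a RESEARCH ROUTE; no claim beyond the stated class; X11b stays CONSTRUCTION-SHAPED;
nothing here changes a label; no named fact is minted (definitions with bodies and theorems; no
`sorry`).

## What this file does (the mechanism of JSW17 Lemma 3.3.3 / atom (L10), as a kernel theorem)

For a profinite group `G`, a continuous surjection `κ : G ↠ ℤ_p` with kernel `H`, `γ ∈ G` with
`κ(γ) = 1`, and a `p`-primary discrete `G`-module `A` (open stabilisers), using the tree's coinduced
module `M_G^H(A)` (Serre I §2.5), Shapiro's lemma (retraction `CohomologicalDimensionProofs`,
injectivity `ShapiroInjective`), the short exact sequence `0 → A → M_G^H(A) →(S_γ − 1) M_G^H(A) → 0`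
(`CoinducedShiftExact`) and the long exact sequence (`ContinuousCohomologyConnecting`):

* `sh` — the Shapiro map `H¹(G, M_G^H(A)) → H¹(H, A) = subgroupH1 H A` ("valeur au point `1`"),
  `sh_surjective`, `sh_injective`; `sh_cohomologyMap_unitHom` (`sh ∘ H¹(unit) = res`);
  **`sh_cohomologyMap_tHom`: `sh ∘ H¹(S_γ − 1) = (conj_{γ⁻¹} − 1) ∘ sh`** (cocycle computation);
* **(a) `exists_resSubgroup_eq_of_conjH1_eq`** — every `conj_γ`-invariant class of `H¹(H, A)` is
  the restriction of a class of `H¹(G, A)` (JSW: "the maps `H¹(K_w, W) → H¹(K_w, M)^Γ` are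
  surjective"; inflation–restriction with `H²(ℤ_p, A^H) = 0`);
* **(b) `exists_conjH1_sub_eq_of_subsingleton`** — if `H²(G, A) = 0` then EVERY class of
  `H¹(H, A)` is `conj_γ y − y` (JSW Lemma 3.3.3, first half: `H¹(K, M)_Γ ↪ H²(K, W)`).

Intended uses (successor files): `G = Γ_K`, `κ` the anticyclotomic `ℤ_p`-extension, `A = E[p^∞]`
(then (b) + `H²(Γ_K, E[p^∞]) = 0` is `H¹(K_∞, E[p^∞])_Γ = 0`), and `G = D_v` a decomposition group
(then (a) is the local surjectivity in JSW's second half). No label changes; (L10) itself is NOT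
discharged here.

References: [JetchevSkinnerWan2017] Lemma 3.3.3 (arXiv:1512.06894 pp. 11–12);
[SerreGaloisCohomology1997] I §2.2, I §2.5 Prop. 10, I §2.6 (b); [Castella2018] Thm. 2.3
(arXiv:1704.06608 p. 5).
-/

noncomputable section

open CategoryTheory Function
open Literature.NumberTheory.GaloisRepresentations Literature.NumberTheory.EllipticCurves

universe u

namespace Summit.BirchSwinnertonDyer.Rank1Residual.X11b.ProcyclicDescent

/-! ## 5. The Shapiro map `sh : H¹(G, M_G^H(A)) → H¹(H, A)`: surjective, injective, carries
`H¹(unit)` to `res` and `H¹(S_γ)` to `conj_{γ⁻¹}` -/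

section Shapiro

variable {G : Type u} [Group G] [TopologicalSpace G] [IsTopologicalGroup G] [CompactSpace G]
variable {A : Type u} [AddCommGroup A] [DistribMulAction G A] [TopologicalSpace A]
  [DiscreteTopology A]
variable (hA : ∀ a : A, IsOpen {g : G | g • a = a}) (H : Subgroup G)

/-- **The Shapiro map** `sh : H¹(G, M_G^H(A)) → H¹(H, A)` ("valeur au point `1`" after restriction
to `H`, Serre I §2.5 Prop. 10), valued in the tree's `subgroupH1 H A`.
[cite: SerreGaloisCohomology1997, I §2.5 Prop. 10] -/
def sh : continuousCohomology 1 (coindRep (subRep hA H)).toTopRep →+ subgroupH1 H A :=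
  (ContinuousCohomology.map (Literature.NumberTheory.GaloisRepresentations.subgroupIncl H) (coindEvalOne (subRep hA H)) 1).hom.toLinearMap
    |>.toAddMonoidHom

/-- Unfolding `sh`. [folklore] -/
theorem sh_apply (y : continuousCohomology 1 (coindRep (subRep hA H)).toTopRep) :
    sh hA H y = (ContinuousCohomology.map (Literature.NumberTheory.GaloisRepresentations.subgroupIncl H) (coindEvalOne (subRep hA H)) 1).hom y :=
  rfl

/-- `sh` on cocycles: `sh [Φ] = [h ↦ Φ(h)(1)]`. [cite: SerreGaloisCohomology1997, I §2.5] -/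
theorem sh_oneCocycleClass (Φ : contOneCocycles (coindRep (subRep hA H)).toTopRep) :
    sh hA H (oneCocycleClass _ Φ) = oneCocycleClass (discreteTopRep H A)
      (contOneCocycles.pullback (Literature.NumberTheory.GaloisRepresentations.subgroupIncl H) (coindEvalOne (subRep hA H)) Φ) :=
  map_oneCocycleClass _ _ _ Φ

/-- **Shapiro surjectivity**: `sh` is onto (the tree's retraction `extCochainsMap`, Serre I §2.5
Prop. 10 via the continuous section of I §1.2 Prop. 1). [cite: SerreGaloisCohomology1997, I §2.5 Prop. 10] -/
theorem sh_surjective [T2Space G] [TotallyDisconnectedSpace G] (hH : IsClosed (H : Set G)) :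
    Surjective (sh hA H) := by
  haveI : CompactSpace H := isCompact_iff_compactSpace.mp hH.isCompact
  obtain ⟨r, hr, hrS⟩ := exists_continuousMap_mul_eq H hH
  let Λ₀ : (subRep hA H).toTopRep.ρ.coindV (Literature.NumberTheory.GaloisRepresentations.subgroupIncl H) →L[ℤ]
      ((coindRep (subRep hA H)).toTopRep : Type u) :=
    { toFun := fun φ => φ
      map_add' := fun _ _ => rfl
      map_smul' := fun _ _ => rfl
      cont := continuous_id }
  have hcomp : HomologicalComplex.homologyMap
      (extCochainsMap (coindRep (subRep hA H)).toTopRep hr Λ₀ (fun _ _ => rfl)) 1 ≫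
      ContinuousCohomology.map (Literature.NumberTheory.GaloisRepresentations.subgroupIncl H) (coindEvalOne (subRep hA H)) 1 = 𝟙 _ := by
    rw [ContinuousCohomology.map, ← HomologicalComplex.homologyMap_comp,
      extCochainsMap_comp_cochainsMap (coindRep (subRep hA H)).toTopRep hr Λ₀ (fun _ _ => rfl)
        (coindEvalOne (subRep hA H)) (fun _ => rfl) hrS, HomologicalComplex.homologyMap_id]
  intro x
  have key : (ContinuousCohomology.map (Literature.NumberTheory.GaloisRepresentations.subgroupIncl H)
      (coindEvalOne (subRep hA H)) 1).hom ((HomologicalComplex.homologyMap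
        (extCochainsMap (coindRep (subRep hA H)).toTopRep hr Λ₀ (fun _ _ => rfl)) 1).hom x) = x := by
    simpa using congr_arg (fun φ => φ.hom x) hcomp
  exact ⟨_, key⟩

/-- **Shapiro injectivity** (tree: `map_shapiro_eq_zero_imp`). [cite: SerreGaloisCohomology1997, I §2.5 Prop. 10] -/
theorem sh_injective [T2Space G] [TotallyDisconnectedSpace G] (hH : IsClosed (H : Set G)) :
    Injective (sh hA H) := by
  haveI : IsClosed (H : Set G) := hH
  rw [injective_iff_map_eq_zero]
  intro y hy
  exact map_shapiro_eq_zero_imp (subRep hA H) 0 y hy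

/-- **`sh ∘ H¹(unit) = res`**: on cocycles, `(unit (c g))(1) = 1 • c(g) = c(g)`.
[cite: SerreGaloisCohomology1997, I §2.5] -/
theorem sh_cohomologyMap_unitHom (z : continuousCohomology 1 (discreteRep hA).toTopRep) :
    sh hA H (cohomologyMap (unitHom hA H) 1 z) =
      ResKernel.resSubgroup H A (z : discreteH1 G A) := by
  obtain ⟨c, rfl⟩ := oneCocycleClass_surjective _ z
  rw [cohomologyMap_oneCocycleClass, sh_oneCocycleClass]
  erw [ResKernel.resSubgroup_oneCocycleClass]
  congr 1
  refine Subtype.ext (ContinuousMap.ext fun h => ?_)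
  exact one_smul G _

end Shapiro

/-! ## 6. `sh ∘ H¹(S_γ − 1) = (conj_{γ⁻¹} − 1) ∘ sh`, and the two descent theorems -/

section Descent

variable {G : Type u} [Group G] [TopologicalSpace G] [IsTopologicalGroup G] [CompactSpace G]
variable {A : Type u} [AddCommGroup A] [DistribMulAction G A] [TopologicalSpace A]
  [DiscreteTopology A]
variable (hA : ∀ a : A, IsOpen {g : G | g • a = a}) (H : Subgroup G) [H.Normal] (γ : G)

/-- **The Shapiro map intertwines `H¹(S_γ − 1)` on `H¹(G, M_G^H(A))` with `conj_{γ⁻¹} − 1` on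
`H¹(H, A)`**: `sh (H¹(S_γ − 1) y) = conj_{γ⁻¹} (sh y) − sh y` (cocycle computation: for a crossed
homomorphism `Φ : G → M_G^H(A)` and `k = γ h γ⁻¹`, `Φ(h)(γ) = Φ(k)(1) + k • w − w` with
`w = Φ(γ)(1)`, whence `γ⁻¹ • Φ(h)(γ) − γ⁻¹ • Φ(γ h γ⁻¹)(1) = h • v − v`, `v = γ⁻¹ • w`).
[cite: SerreGaloisCohomology1997, I §2.5] [cite: JetchevSkinnerWan2017, Lemma 3.3.3 (arXiv:1512.06894 p. 11)] -/
theorem sh_cohomologyMap_tHom (y : continuousCohomology 1 (coindRep (subRep hA H)).toTopRep) :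
    sh hA H (cohomologyMap (tHom hA H γ) 1 y) = conjH1 H A γ⁻¹ (sh hA H y) - sh hA H y := by
  obtain ⟨Φ, rfl⟩ := oneCocycleClass_surjective _ y
  rw [cohomologyMap_oneCocycleClass, sh_oneCocycleClass, sh_oneCocycleClass, conjH1_oneCocycleClass,
    ← sub_eq_zero, ← oneCocycleClass_sub, ← oneCocycleClass_sub]
  -- the constant `v = γ⁻¹ • Φ(γ)(1)` whose coboundary is the difference
  set w : A := ((Φ.1 γ : coindModule (subRep hA H)) : C(G, A)) 1 with hw
  have hcont : Continuous fun h : H => h • (γ⁻¹ • w) :=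
    (continuous_smul_const hA (γ⁻¹ • w)).comp continuous_subtype_val
  rw [← oneCocycleClass_cobCocycle (γ⁻¹ • w) hcont]
  congr 1
  apply Subtype.ext
  ext h
  -- the cocycle identity `Φ(h)(γ) = Φ(k)(1) + k • w − w`, `k = γ h γ⁻¹`
  have hk : γ * (h : G) * γ⁻¹ ∈ H := Subgroup.Normal.conj_mem inferInstance (h : G) h.2 γ
  have e1 := Φ.2 (γ * (h : G) * γ⁻¹) γ
  have e2 := Φ.2 γ (h : G)
  have e3 : γ * (h : G) * γ⁻¹ * γ = γ * (h : G) := by group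
  rw [e3, e2] at e1
  have e4 := congrArg (fun m : coindModule (subRep hA H) => (m : C(G, A)) 1) e1
  simp only at e4
  change ((Φ.1 γ : coindModule (subRep hA H)) : C(G, A)) 1 +
      ((Φ.1 (h : G) : coindModule (subRep hA H)) : C(G, A)) (1 * γ) =
    ((Φ.1 (γ * (h : G) * γ⁻¹) : coindModule (subRep hA H)) : C(G, A)) 1 +
      ((Φ.1 γ : coindModule (subRep hA H)) : C(G, A)) (1 * (γ * (h : G) * γ⁻¹)) at e4
  rw [one_mul, one_mul, show γ * (h : G) * γ⁻¹ = ((⟨_, hk⟩ : H) : G) * 1 from (mul_one _).symm,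
    coind_apply_mul, mul_one] at e4
  -- `e4 : w + Φ(h)(γ) = Φ(k)(1) + k • w`
  rw [sub_apply_val, sub_apply_val, cobCocycle_apply, conjCocycle_apply]
  change (γ⁻¹ • ((Φ.1 (h : G) : coindModule (subRep hA H)) : C(G, A)) (γ * 1) -
      ((Φ.1 (h : G) : coindModule (subRep hA H)) : C(G, A)) 1) -
      (γ⁻¹ • ((Φ.1 (γ⁻¹⁻¹ * (h : G) * γ⁻¹) : coindModule (subRep hA H)) : C(G, A)) 1 -
        ((Φ.1 (h : G) : coindModule (subRep hA H)) : C(G, A)) 1) = (h : G) • (γ⁻¹ • w) - γ⁻¹ • w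
  rw [inv_inv, mul_one]
  have e5 : ((Φ.1 (h : G) : coindModule (subRep hA H)) : C(G, A)) γ =
      ((Φ.1 (γ * (h : G) * γ⁻¹) : coindModule (subRep hA H)) : C(G, A)) 1 +
        (γ * (h : G) * γ⁻¹) • w - w := by
    rw [← e4]; abel
  rw [e5, smul_sub, smul_add, smul_smul, smul_smul, show γ⁻¹ * (γ * (h : G) * γ⁻¹) =
    (h : G) * γ⁻¹ by group]
  abel

variable {p : ℕ} [Fact p.Prime] (κ : G →ₜ* Multiplicative ℤ_[p]) (hκ : Surjective κ)
  (hγ : κ γ = Multiplicative.ofAdd 1) (hAt : IsPrimaryTorsion p A)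

omit [CompactSpace G] in
/-- `conj_γ x = x ⟹ conj_{γ⁻¹} x = x`. [folklore] -/
theorem conjH1_inv_eq_of_conjH1_eq (x : subgroupH1 H A) (hx : conjH1 H A γ x = x) :
    conjH1 H A γ⁻¹ x = x := by
  conv_lhs => rw [← hx]
  rw [← AddMonoidHom.comp_apply, ← conjH1_mul_holds H A γ⁻¹ γ, inv_mul_cancel,
    conjH1_one_holds H A, AddMonoidHom.id_apply]

include hA hκ hγ hAt in
/-- **(a) Restriction is onto the `γ`-invariants: `H¹(G, A) ↠ H¹(H, A)^{conj_γ}`** for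
`H = ker(κ : G ↠ ℤ_p)`, `κ(γ) = 1`, `A` a `p`-primary discrete `G`-module over a profinite `G` —
the inflation–restriction sequence `H¹(G, A) → H¹(H, A)^{G/H} → H²(G/H, A^H)` with
`H²(ℤ_p, A^H) = 0`, obtained here as: `conj_γ x = x` ⟹ `sh⁻¹ x` is killed by `H¹(S_γ − 1)`
(`sh_cohomologyMap_tHom`, Shapiro injectivity) ⟹ `sh⁻¹ x ∈ im H¹(unit)` (exactness of the tree's
long exact sequence at `H¹(M_G^H(A))`) ⟹ `x = res z` (`sh ∘ H¹(unit) = res`). JSW17: "the maps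
`H¹(K_w, W) → H¹(K_w, M)^Γ` are surjective".
[cite: JetchevSkinnerWan2017, Lemma 3.3.3 (arXiv:1512.06894 p. 12)] [cite: SerreGaloisCohomology1997, I §2.5 Prop. 10, I §2.6 (b)] -/
theorem exists_resSubgroup_eq_of_conjH1_eq [T2Space G] [TotallyDisconnectedSpace G]
    (x : subgroupH1 (kerK κ) A) (hx : conjH1 (kerK κ) A γ x = x) :
    ∃ z : discreteH1 G A, ResKernel.resSubgroup (kerK κ) A z = x := by
  obtain ⟨y, rfl⟩ := sh_surjective hA (kerK κ) (isClosed_kerK κ) x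
  have h0 : sh hA (kerK κ) (cohomologyMap (tHom hA (kerK κ) γ) 1 y) = 0 := by
    rw [sh_cohomologyMap_tHom, conjH1_inv_eq_of_conjH1_eq (kerK κ) γ _ hx, sub_self]
  have h1 : cohomologyMap (tHom hA (kerK κ) γ) 1 y = 0 :=
    (injective_iff_map_eq_zero _).1 (sh_injective hA (kerK κ) (isClosed_kerK κ)) _ h0
  obtain ⟨z, rfl⟩ :=
    (isSES_unit_tHom hA κ hκ hγ hAt).exists_map_one_eq_of_map_one_eq_zero y h1
  exact ⟨z, (sh_cohomologyMap_unitHom hA (kerK κ) z).symm⟩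

include hκ hγ hAt in
/-- **(b) Trivial coinvariants from `H²(G, A) = 0`: `H¹(H, A) = (conj_γ − 1) H¹(H, A)`** for
`H = ker(κ : G ↠ ℤ_p)`, `κ(γ) = 1`, `A` a `p`-primary discrete `G`-module over a profinite `G` with
`H²(G, A) = 0` — JSW17 Lemma 3.3.3, first half ("the long exact sequence … yields an injection
`H¹(K, M)_Γ ↪ H²(K, W)`"): `x = sh y` (Shapiro surjectivity), `δ₁ y = 0` (`H² = 0`) ⟹
`y = H¹(S_γ − 1) y'` (exactness at `H¹(M_G^H(A))`) ⟹ `x = conj_{γ⁻¹} u − u = conj_γ(−conj_{γ⁻¹} u)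
− (−conj_{γ⁻¹} u)`, `u = sh y'`.
[cite: JetchevSkinnerWan2017, Lemma 3.3.3 (arXiv:1512.06894 pp. 11–12)] [cite: SerreGaloisCohomology1997, I §2.5 Prop. 10, I §2.2] -/
theorem exists_conjH1_sub_eq_of_subsingleton [T2Space G] [TotallyDisconnectedSpace G]
    (h2 : Subsingleton (continuousCohomology 2 (discreteRep hA).toTopRep))
    (x : subgroupH1 (kerK κ) A) :
    ∃ y : subgroupH1 (kerK κ) A, conjH1 (kerK κ) A γ y - y = x := by
  obtain ⟨z, rfl⟩ := sh_surjective hA (kerK κ) (isClosed_kerK κ) x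
  have hδ : (isSES_unit_tHom hA κ hκ hγ hAt).δ₁ z = 0 := Subsingleton.elim _ _
  obtain ⟨z', rfl⟩ := (isSES_unit_tHom hA κ hκ hγ hAt).exists_map_one_eq_of_δ₁_eq_zero z hδ
  refine ⟨-(conjH1 (kerK κ) A γ⁻¹ (sh hA (kerK κ) z')), ?_⟩
  rw [sh_cohomologyMap_tHom, map_neg, ← AddMonoidHom.comp_apply, ← conjH1_mul_holds (kerK κ) A γ γ⁻¹,
    mul_inv_cancel, conjH1_one_holds (kerK κ) A, AddMonoidHom.id_apply]
  abel

end Descent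

end Summit.BirchSwinnertonDyer.Rank1Residual.X11b.ProcyclicDescent

end
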